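import Literature.IUT.HodgeArakelov.AbsTopMonoidsGenuineIsometries
import Literature.AnabelianGeometry.EtaleTheta.CyclotomeZHatSign
import HarnessLib

/-!
# [IUTchII] Example 1.8 (iv) / Remark 1.11.1 (i) (d) at the GENUINE producer: non-triviality of `Ẑ^× → Ism(G)` and
# `Rmk1111_d` PROVED (proof-only sequel of `AbsTopMonoidsGenuineIsometries.lean`)

S. Mochizuki, *Inter-universal Teichmüller theory II*, §1, Example 1.8 (iv) p. 39 and Remark 1.11.1 (i) (d) p. 50,
kurims manuscript (Dec. 2020) [claim: Mochizuki2012, status: disputed] (IUTchII §1 Rmk 1.11.1 (i), kurims p.50):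
"the underlying ind-topological module of `O^{×μ}(G)` is divisible, hence admits a natural action by `ℚ_p`. In
particular, if, in (b), one replaces `O^×` by `O^{×μ}`, then the resulting description of the kernel [`=` the
automorphisms determined by the natural action of `Ẑ^×`] is false."  abc-iut cell, layer L6, MERGE-MAP §8 row B9 (d)
second half; seat abc-iut-L6-d2 (gen 5).  PROOF-ONLY (no definitions).

For the fully genuine producer `AbsTopMonoids.genuineOfModelIsm S C ε hΔ hq` (`Ism(G)` = print's isometry group,
`Ẑ^× ↠ ℤ_p^× ↪ Ism(G)` = `Genuine.zhatOxmu`):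

* `Genuine.padicChar_negOneAut` — the inversion `−1 ∈ Ẑ^× = Aut(Ẑ)` has `p`-adic cyclotomic character `−1`;
  `Genuine.zhatOxmu_negOneAut`, `actIsm_toIsm_negOneAut` — **`−1` acts on `O^{×μ}(G)` by INVERSION**; hence
  `actIsm_toIsm_ne_one` — **the `Ẑ^×`-action through `Ism(G)` is NOT trivial** (`O^{×μ}(G) ≅ (k̄, +)` has no
  `2`-torsion issue: `char k̄ = 0`);
* **`rmk1111_d_genuineOfModelIsm : Rmk1111_d (genuineOfModelIsm S C ε hΔ hq)`** — abc-iut-L6-t1's named `Prop`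
  **IUTchII:Rmk1.11.1(i) (d)** PROVED non-vacuously: `O^{×μ}(G) ≅ k~` is divisible (`k~` is perfect,
  `MLFClosure.pow_bijective_unitsModTorsion`), and multiplication by `p` through `log_k̄` (`GaloisPadicLog.scalarAut`)
  is a `G`-equivariant automorphism of `O^{×μ}(G)` which is NOT the action of any `u ∈ Ẑ^×` — such a `u` acts as the
  scalar `χ_p(u) ∈ ℤ_p^×`, and `p ∉ ℤ_p^×`.

HONEST FRAMING: classical; record-anchored to a disputed corpus through the locators only; nothing here bears on
[IUTchIII] Cor. 3.12.
-/

set_option autoImplicit false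

noncomputable section

namespace Literature.IUT.HodgeArakelov

open CategoryTheory
open Literature.AnabelianGeometry.AbsoluteAnabelian
open Literature.AnabelianGeometry.EtaleTheta

namespace AbsTopMonoids

namespace Genuine

variable (C : MLFClosure.{0}) [Fact C.residueChar.Prime]

/-- `−1 ∈ Ẑ^×` (inversion of `Ẑ`) has `p`-adic cyclotomic character `−1`.
[cite: RibesZalesskii2010, Thm 2.7.1] -/
theorem padicChar_negOneAut (p : ℕ) [Fact p.Prime] : ZHatLevel.padicChar p ZHatLevel.negOneAut = -1 :=
  (ZHatLevel.eq_padicChar_of_toZModPow p fun k => by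
    rw [map_neg, map_one, ZHatLevel.levelChar_negOneAut]
    rfl).symm

/-- **`−1 ∈ Ẑ^×` acts on `O^{×μ}` by INVERSION** (`log_k̄ x⁻¹ = −log_k̄ x`).
[claim: Mochizuki2012, status: disputed] (IUTchII §1 Ex 1.8 (iv), kurims p.39) -/
theorem zhatOxmu_negOneAut (x : ModTorsion (nonzeroIntegers C.k C.K)ˣ) : zhatOxmu C ZHatLevel.negOneAut x = x⁻¹ := by
  apply (oxmuBridge C).injective
  apply C.logEquiv.injective
  apply Multiplicative.toAdd.injective
  rw [toAdd_log_zhatOxmu, padicChar_negOneAut, map_neg, map_one, map_inv, map_inv, toAdd_inv, neg_one_mul]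

end Genuine

section Producer

open Genuine

variable (S : ThetaSetting.{0}) (C : MLFClosure.{0}) (ε : S.Gk ≃ₜ* (ModelMLFGaloisData.galois C.k C.K).tmPair.Pi)
  (hΔ : ∀ f : S.PiX ≃ₜ* S.PiX, S.DeltaX.map f.toMulEquiv.toMonoidHom = S.DeltaX)
  (hq : Nonempty (TopGroup.quot S.PiX S.DeltaX ≃ₜ* S.Gk))

/-- **`−1 ∈ Ẑ^×` acts through `Ism(G)` by INVERSION on `O^{×μ}(G)`**. [claim: Mochizuki2012, status: disputed] (IUTchII §1 Ex 1.8 (iv), kurims p.39) -/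
theorem actIsm_toIsm_negOneAut (G : IsoClass S.Gk) (x : (genuineOfModelIsm S C ε hΔ hq).Oxmu G) :
    (genuineOfModelIsm S C ε hΔ hq).actIsm G ((genuineOfModelIsm S C ε hΔ hq).toIsm G ZHatLevel.negOneAut) x = x⁻¹ :=
  haveI := C.fact_residueChar_prime
  zhatOxmu_negOneAut C x

/-- **NON-DEGENERACY**: the action of `Ẑ^×` through `Ism(G)` is not trivial (`−1` acts by inversion on the
torsion-free, non-trivial group `O^{×μ}(G) ≅ (k̄, +)`). [claim: Mochizuki2012, status: disputed] (IUTchII §1 Ex 1.8 (iv), kurims p.39) -/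
theorem actIsm_toIsm_ne_one (G : IsoClass S.Gk) :
    (genuineOfModelIsm S C ε hΔ hq).actIsm G ((genuineOfModelIsm S C ε hΔ hq).toIsm G ZHatLevel.negOneAut) ≠ 1 := by
  haveI := C.fact_residueChar_prime
  intro h
  -- the class `x₀` with `log_k̄ x₀ = 1` would satisfy `x₀⁻¹ = x₀`, i.e. `-1 = 1` in `k̄`
  set x₀ : ModTorsion (nonzeroIntegers C.k C.K)ˣ := (oxmuBridge C).symm (C.logEquiv.symm (Multiplicative.ofAdd 1))
  have h1 : zhatOxmu C ZHatLevel.negOneAut x₀ = x₀ := by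
    change (genuineOfModelIsm S C ε hΔ hq).actIsm G ((genuineOfModelIsm S C ε hΔ hq).toIsm G ZHatLevel.negOneAut) x₀ = x₀
    rw [h, MulAut.one_apply]
  have h2 := congrArg (fun y => Multiplicative.toAdd (C.logEquiv (oxmuBridge C y))) h1
  simp only [toAdd_log_zhatOxmu, padicChar_negOneAut, map_neg, map_one, x₀, MulEquiv.apply_symm_apply, toAdd_ofAdd,
    mul_one] at h2
  haveI : CharZero C.K := charZero_of_injective_algebraMap (algebraMap C.k C.K).injective
  exact absurd h2 (by norm_num)

/-- **IUTchII:Rmk1.11.1(i) (d) PROVED for the genuine producer** ([IUTchII] Rmk. 1.11.1 (i) (d) p. 50: "the underlying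
… module of `O^{×μ}(G)` is divisible, hence admits a natural action by `ℚ_p`. In particular, if, in (b), one replaces
`O^×` by `O^{×μ}`, then the resulting description of the kernel is false"): `O^{×μ}(G) ≅ (k̄, +)` is divisible, and
multiplication by `p` (through `log_k̄`) is a `G`-equivariant automorphism of `O^{×μ}(G)` which is NOT the action of
any `u ∈ Ẑ^×` (that acts as the UNIT `χ_p(u)`, while `p ∉ ℤ_p^×`). abc-iut-L6-t1's named `Prop`, non-vacuously.
[claim: Mochizuki2012, status: disputed] (IUTchII §1 Rmk 1.11.1 (i), kurims p.50) -/
theorem rmk1111_d_genuineOfModelIsm : Rmk1111_d (genuineOfModelIsm S C ε hΔ hq) := by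
  haveI := C.fact_residueChar_prime
  haveI : CharZero C.K := charZero_of_injective_algebraMap (algebraMap C.k C.K).injective
  intro G
  refine ⟨fun n hn x => ?_, ?_⟩
  · -- divisibility of `O^{×μ} ≅ k~` (`k~` is perfect)
    obtain ⟨y, hy⟩ := (C.pow_bijective_unitsModTorsion hn).2 (oxmuBridge C x)
    refine ⟨(oxmuBridge C).symm y, ?_⟩
    change ((oxmuBridge C).symm y : ModTorsion (nonzeroIntegers C.k C.K)ˣ) ^ n =
      (x : ModTorsion (nonzeroIntegers C.k C.K)ˣ)
    apply (oxmuBridge C).injective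
    rw [map_pow, MulEquiv.apply_symm_apply]
    exact hy
  · -- `ψ :=` multiplication by `p` through `log_k̄`
    have hp0 : (C.residueChar : C.K) ≠ 0 := Nat.cast_ne_zero.mpr (Fact.out : C.residueChar.Prime).ne_zero
    let c : (C.K)ˣ := Units.mk0 (C.residueChar : C.K) hp0
    let ψ : MulAut (ModTorsion (nonzeroIntegers C.k C.K)ˣ) := MulAut.congr (oxmuBridge C).symm (C.galoisPadicLog.scalarAut c)
    have hψ : ∀ x, oxmuBridge C (ψ x) = C.galoisPadicLog.scalarAut c (oxmuBridge C x) := fun x => by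
      change oxmuBridge C ((oxmuBridge C).symm (C.galoisPadicLog.scalarAut c ((oxmuBridge C).symm.symm x))) = _
      rw [MulEquiv.apply_symm_apply, MulEquiv.symm_symm]
    refine ⟨ψ, fun g x => ?_, fun u hu => ?_⟩
    · -- `G`-equivariance: `p ∈ k` is fixed by `G_k`
      have hact : ∀ y, (genuineOfModelIsm S C ε hΔ hq).actOxmu G g y =
          actionModTorsion (unitsActionOf C (Genuine.theta C ε G).toMonoidHom) g y := fun y => by
        induction y using QuotientGroup.induction_on with
        | H z => rfl
      rw [hact, hact]
      apply (oxmuBridge C).injective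
      change oxmuBridge C (ψ (actionModTorsion (unitsActionOf C (Genuine.theta C ε G).toMonoidHom) g x)) =
        oxmuBridge C (actionModTorsion (unitsActionOf C (Genuine.theta C ε G).toMonoidHom) g (ψ x))
      rw [hψ, oxmuBridge_actionModTorsion, oxmuBridge_actionModTorsion, hψ]
      exact C.galoisPadicLog.scalarAut_unitsModTorsionGaloisMap _ c (by simp [c]) _
    · -- `ψ` is not the action of `u`: compare on the class with `log_k̄ = 1`
      set x₀ : ModTorsion (nonzeroIntegers C.k C.K)ˣ := (oxmuBridge C).symm (C.logEquiv.symm (Multiplicative.ofAdd 1))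
      have h1 := congrArg (fun φ => Multiplicative.toAdd (C.logEquiv (oxmuBridge C (φ x₀)))) hu
      change Multiplicative.toAdd (C.logEquiv (oxmuBridge C (ψ x₀))) =
        Multiplicative.toAdd (C.logEquiv (oxmuBridge C (zhatOxmu C u x₀))) at h1
      have e1 : Multiplicative.toAdd (C.logEquiv (C.galoisPadicLog.scalarAut c (oxmuBridge C x₀))) =
          (c : C.K) * Multiplicative.toAdd (C.logEquiv (oxmuBridge C x₀)) :=
        C.galoisPadicLog.toAdd_logEquiv_scalarAut c _
      rw [hψ, e1, toAdd_log_zhatOxmu] at h1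
      simp only [x₀, MulEquiv.apply_symm_apply, toAdd_ofAdd, mul_one] at h1
      -- `p = χ_p(u)` in `k̄`, hence in `ℤ_p`: impossible, `χ_p(u)` is a unit and `p` is not
      have h2 : C.padicScalar (C.residueChar : ℤ_[C.residueChar]) = C.padicScalar (ZHatLevel.padicChar C.residueChar u) := by
        rw [map_natCast, ← h1]; rfl
      have h3 := C.padicScalar_injective h2
      have h4 : IsUnit ((C.residueChar : ℕ) : ℤ_[C.residueChar]) := by
        rw [h3]; exact ZHatLevel.isUnit_padicChar _ u
      exact PadicInt.not_isUnit_iff.mpr ((PadicInt.norm_lt_one_iff_dvd _).mpr dvd_rfl) h4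

end Producer

end AbsTopMonoids

end Literature.IUT.HodgeArakelov

end
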